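import Summits.BirchSwinnertonDyer.Rank1Residual.X12.CMRungLeaves
import Summits.BirchSwinnertonDyer.Rank1Residual.X12.O11.CSevenFullBSD
import Summits.BirchSwinnertonDyer.Rank1Residual.X12.CubeSumSylvesterAtTwo
import Summits.BirchSwinnertonDyer.Rank1Residual.P2.CMRankOneAtTwoHeegnerIndexHalves
import Summits.BirchSwinnertonDyer.Rank1Residual.X12.ClassClosureO10Readings
import Summits.BirchSwinnertonDyer.Rank1Residual.Additive.QuadraticBranchPeriodRatioOfManinFact
import Literature.NumberTheory.EllipticCurves.Rank1Residual.Typed.X12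

set_option linter.dupNamespace false
set_option autoImplicit false

open scoped Classical

/-!
# CM rung inputs — Theorems-side BRIDGE for the three D-0059 rung routes (D-0061 leaves)

Director-bsd 2026-08-25T19:23Z (D-0059 ROUTE MECHANICS): a gate-rendered route file
`BirchSwinnertonDyer/Theses/<Slug>.lean` may import only Mathlib / Literature / HarnessLib,
`Summits.BirchSwinnertonDyer.Statement` and `Summits.BirchSwinnertonDyer.BirchSwinnertonDyer.Theorems.*`.
This module is the bridge: it imports the rung LEAVES `X12.CMRamifiedSeven` (K7r), `X12.CMAtTwo`
(K7t), `X12.CMInertBad` (K8) of `Rank1Residual/X12/CMRungLeaves.lean` (p405122) together with the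
landed CONSUMER theorems of the bsd-cm cell, and proves, sorry-free, one implication per rung

* `cmRamifiedSeven_of_inputs : (R-EU)@7 → (R-tors)@7 → (R-ctrl)@7 → frame data @7 → published facts → X12.CMRamifiedSeven`
  (via `X12.ClassCSeven.forall_bsdp_of_O11_halves`, p397188);
* `cmAtTwo_of_inputs : Heegner-index lower half on 𝒞_HSY → upper half → published facts → X12.CMAtTwo`
  (via `P2.bsdp_two_iff_cmHeegnerIndex`, p396383, and `X12.CubeSumFamilies.bsdp_three_of_thm14'`);
* `cmInertBad_of_inputs : C-cc-1 on (p, I₀*) → off-type residual → p = 3 residual → print readings → published facts → X12.CMInertBad`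
  (via `X12.O10.bsdp_of_hasSignedLocalType_IstarZero_of_valuation_of_readings`, p402929, with the
  period datum from `Additive.periodRatio_of_mazur`, p404221, and `Typed.missingPPartAt_of_bsdp`).

The hypotheses are spelled out VERBATIM as the item statements of the routes
`RamifiedSevenEllipticUnits`, `SylvesterTwoHeegnerIndex`, `InertBadSignedBranches` (planner
bsd-cm-plan g9, `HOME/bsd-cm-plan/g9/routes/`), so each route's deciding theorem is the one-liner
`closes h₁ … h_k := <rung>_of_inputs h₁ … h_k`. Nothing is asserted: every unproved input is a
hypothesis. No new `def`, no `@[conjecture]`, standard axioms.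
-/

namespace Summit.BirchSwinnertonDyer.BirchSwinnertonDyer.Rank1Residual.CMRungInputs


/-- K7r. The three O11 cruxes at `p = 7` on 𝒞₇, the frame data at `7` and the published facts give
the rung leaf `X12.CMRamifiedSeven` (`BSD(E, p)` for every `E ∈ 𝒞₇` and every prime `p`), by the landed
class consumer `X12.ClassCSeven.forall_bsdp_of_O11_halves`. -/
theorem cmRamifiedSeven_of_inputs
(h₁ : ∀ (W : WeierstrassCurve ℚ) [W.IsElliptic] [W.IsGloballyMinimal] [Fact (Nat.Prime 7)],
      Summit.BirchSwinnertonDyer.Rank1Residual.X12.ClassCSeven W →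
      Summit.BirchSwinnertonDyer.Rank1Residual.X12.O11.RamifiedCMEllipticUnitIndexAt W 7)
(h₂ : ∀ (W : WeierstrassCurve ℚ) [W.IsElliptic] [W.IsGloballyMinimal] [Fact (Nat.Prime 7)],
      Summit.BirchSwinnertonDyer.Rank1Residual.X12.ClassCSeven W →
      Summit.BirchSwinnertonDyer.Rank1Residual.X12.O11.RamifiedCMStrictTorsionAt W 7)
(h₃ : ∀ (W : WeierstrassCurve ℚ) [W.IsElliptic] [W.IsGloballyMinimal] [Fact (Nat.Prime 7)],
      Summit.BirchSwinnertonDyer.Rank1Residual.X12.ClassCSeven W →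
      Summit.BirchSwinnertonDyer.Rank1Residual.X12.O11.RamifiedCMStrictControlAt W 7)
(h₄ : ∀ (W : WeierstrassCurve ℚ) [W.IsElliptic] [W.IsGloballyMinimal] [Fact (Nat.Prime 7)],
      Summit.BirchSwinnertonDyer.Rank1Residual.X12.ClassCSeven W → ∃ (K : Type) (_ : Field K) (_ :
      NumberField K) (𝔭 : IsDedekindDomain.HeightOneSpectrum (NumberField.RingOfIntegers K)) (W' :
      WeierstrassCurve ℚ) (_ : W'.IsElliptic) (_ : W'.IsGloballyMinimal) (C :
      WeierstrassCurve.VariableChange ℚ) (κ : Literature.NumberTheory.EllipticCurves.ZpExtension K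
      7) (γ : Field.absoluteGaloisGroup K) (_ : Fact (κ.IsTopGenerator γ)) (P : W.toAffine.Point) (n
      : ℕ) (P' : W'.toAffine.Point) (n' : ℕ),
      Summit.BirchSwinnertonDyer.Rank1Residual.X12.O11.IsFrame W 7 K 𝔭 W' C ∧
      WeierstrassCurve.IsIsogenous W W' ∧ κ.IsAnticyclotomic ∧ ¬ IsOfFinAddOrder P ∧ (∀ R :
      W.toAffine.Point, ∃ (k : ℤ) (T : W.toAffine.Point), IsOfFinAddOrder T ∧ R = k • P + T) ∧ (∀ Q
      : (W.baseChange ℚ_[7]).toAffine.Point, 7 • Q = 0 → Q = 0) ∧ (∃ Q : (W.baseChange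
      ℚ_[7]).toAffine.Point, 7 ^ n • Q = W.toPadicPoint 7 P) ∧ (∀ Q : (W.baseChange
      ℚ_[7]).toAffine.Point, 7 ^ (n + 1) • Q ≠ W.toPadicPoint 7 P) ∧ ¬ IsOfFinAddOrder P' ∧ (∀ R :
      W'.toAffine.Point, ∃ (k : ℤ) (T : W'.toAffine.Point), IsOfFinAddOrder T ∧ R = k • P' + T) ∧ (∀
      Q : (W'.baseChange ℚ_[7]).toAffine.Point, 7 • Q = 0 → Q = 0) ∧ (∃ Q : (W'.baseChange
      ℚ_[7]).toAffine.Point, 7 ^ n' • Q = W'.toPadicPoint 7 P') ∧ (∀ Q : (W'.baseChange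
      ℚ_[7]).toAffine.Point, 7 ^ (n' + 1) • Q ≠ W'.toPadicPoint 7 P'))
(h₅ : Literature.NumberTheory.EllipticCurves.bsdTriple_of_hasCM_of_L_one_ne_zero ∧
      WeierstrassCurve.hasEntireLFunction_rat ∧
      Literature.NumberTheory.EllipticCurves.LiLiuTian2024.thm11_bsdp_of_cm_rank_one ∧
      Literature.NumberTheory.EllipticCurves.Kobayashi2013.cor14_bsdp_of_cm_rank_one ∧
      Literature.NumberTheory.EllipticCurves.LiTianYanZhu2025.thm11_bsdp_of_cm_rank_one ∧
      Literature.NumberTheory.EllipticCurves.GrossZagier1986_thm_I_7_3 ∧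
      Literature.NumberTheory.EllipticCurves.rank_eq_analyticRank_of_analyticRank_le_one ∧
      WeierstrassCurve.bsdRHS_eq_of_isIsogenous) :
    Summit.BirchSwinnertonDyer.Rank1Residual.X12.CMRamifiedSeven := by
  intro W _ _ hW p hp
  haveI h7 : Fact (Nat.Prime 7) := ⟨by norm_num⟩
  obtain ⟨hCM, hmod, hLLT, hKob, hLTYZ, hGZ, hGZK, hCassels⟩ := h₅
  obtain ⟨K, _, _, 𝔭, W', _, _, C, κ, γ, _, P, n, P', n', hF, hiso, hκ, hP, hgen, htors, hdiv, hndiv,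
    hP', hgen', htors', hdiv', hndiv'⟩ := h₄ W hW
  exact Summit.BirchSwinnertonDyer.Rank1Residual.X12.ClassCSeven.forall_bsdp_of_O11_halves hCM hmod
    hLLT hKob hLTYZ hGZ hGZK hCassels hW (h₂ W hW) (h₃ W hW) (h₁ W hW) hF hiso hκ γ hP hgen htors hdiv
    hndiv hP' hgen' htors' hdiv' hndiv' p hp


/-- K7t. The two halves of the `2`-adic Heegner-index identity on 𝒞_HSY and the published facts give
the rung leaf `X12.CMAtTwo` (`BSD(E_p, 2)` on 𝒞_HSY), by the landed `L`-free equivalence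
`P2.bsdp_two_iff_cmHeegnerIndex`. -/
theorem cmAtTwo_of_inputs
(hlo : ∀ (p : ℕ), p.Prime → (p % 9 = 4 ∨ p % 9 = 7) → (¬ ∃ x : ZMod p, x ^ 3 = 3) → ∀ (W :
      WeierstrassCurve ℚ) [W.IsElliptic] [W.IsGloballyMinimal], (∃ C :
      WeierstrassCurve.VariableChange ℚ, C • W =
      Literature.NumberTheory.EllipticCurves.HuShuYin2019.cubeSumCurve (p : ℚ)) → ∀ (N : ℕ) [NeZero
      N] (K : Type) [Field K] [NumberField K] (Dt :
      Literature.NumberTheory.EllipticCurves.ModularForms.ModularParametrizationData W N) (H :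
      Literature.NumberTheory.EllipticCurves.HeegnerDatum N (NumberField.discr K)) (ι : K →+* ℂ) (P
      : (W.baseChange K).toAffine.Point) (Wd : WeierstrassCurve ℚ) [Wd.IsElliptic]
      [Wd.IsGloballyMinimal] (Cd : WeierstrassCurve.VariableChange ℚ) (k : ℕ), W.HasCM →
      W.analyticRank = 1 → Literature.NumberTheory.EllipticCurves.IsImaginaryQuadratic K →
      Literature.NumberTheory.EllipticCurves.SatisfiesHeegnerHypothesis N K →
      WeierstrassCurve.Affine.Point.map ι.toRatAlgHom P =
      Literature.NumberTheory.EllipticCurves.ModularForms.heegnerPointComplex Dt H →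
      (W.quadraticTwist (NumberField.discr K : ℚ)).entireLFunction 1 ≠ 0 → Cd • W.quadraticTwist
      (NumberField.discr K : ℚ) = Wd → (k = 1 ∨ k = 2) → (k = 2 ↔ ∀ y : W.toAffine.Point, ∃ Q :
      (W.baseChange K).toAffine.Point, WeierstrassCurve.QuadraticDescent.incl K W y - (2 : ℤ) • Q ∈
      AddCommGroup.torsion (W.baseChange K).toAffine.Point) → padicValRat 2
      (Summit.BirchSwinnertonDyer.Rank1Residual.P2.cmHeegnerIndexQuotient W K P Dt.c k Wd Cd.u) ≤
      padicValNat 2 (Nat.card W.sha))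
(hup : ∀ (p : ℕ), p.Prime → (p % 9 = 4 ∨ p % 9 = 7) → (¬ ∃ x : ZMod p, x ^ 3 = 3) → ∀ (W :
      WeierstrassCurve ℚ) [W.IsElliptic] [W.IsGloballyMinimal], (∃ C :
      WeierstrassCurve.VariableChange ℚ, C • W =
      Literature.NumberTheory.EllipticCurves.HuShuYin2019.cubeSumCurve (p : ℚ)) → ∀ (N : ℕ) [NeZero
      N] (K : Type) [Field K] [NumberField K] (Dt :
      Literature.NumberTheory.EllipticCurves.ModularForms.ModularParametrizationData W N) (H :
      Literature.NumberTheory.EllipticCurves.HeegnerDatum N (NumberField.discr K)) (ι : K →+* ℂ) (P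
      : (W.baseChange K).toAffine.Point) (Wd : WeierstrassCurve ℚ) [Wd.IsElliptic]
      [Wd.IsGloballyMinimal] (Cd : WeierstrassCurve.VariableChange ℚ) (k : ℕ), W.HasCM →
      W.analyticRank = 1 → Literature.NumberTheory.EllipticCurves.IsImaginaryQuadratic K →
      Literature.NumberTheory.EllipticCurves.SatisfiesHeegnerHypothesis N K →
      WeierstrassCurve.Affine.Point.map ι.toRatAlgHom P =
      Literature.NumberTheory.EllipticCurves.ModularForms.heegnerPointComplex Dt H →
      (W.quadraticTwist (NumberField.discr K : ℚ)).entireLFunction 1 ≠ 0 → Cd • W.quadraticTwist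
      (NumberField.discr K : ℚ) = Wd → (k = 1 ∨ k = 2) → (k = 2 ↔ ∀ y : W.toAffine.Point, ∃ Q :
      (W.baseChange K).toAffine.Point, WeierstrassCurve.QuadraticDescent.incl K W y - (2 : ℤ) • Q ∈
      AddCommGroup.torsion (W.baseChange K).toAffine.Point) → (padicValNat 2 (Nat.card W.sha) : ℤ) ≤
      padicValRat 2 (Summit.BirchSwinnertonDyer.Rank1Residual.P2.cmHeegnerIndexQuotient W K P Dt.c k
      Wd Cd.u))
(hF : Literature.NumberTheory.EllipticCurves.HuShuYin2019.thm14_threePart_product ∧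
      Literature.NumberTheory.EllipticCurves.bsdTriple_of_hasCM_of_L_one_ne_zero ∧
      WeierstrassCurve.hasEntireLFunction_rat ∧
      Literature.NumberTheory.EllipticCurves.LiLiuTian2024.thm11_bsdp_of_cm_rank_one ∧
      Literature.NumberTheory.EllipticCurves.Kobayashi2013.cor14_bsdp_of_cm_rank_one ∧ (∀ (N : ℕ)
      [NeZero N] (W : WeierstrassCurve ℚ) (K : Type) [Field K] [NumberField K],
      Literature.NumberTheory.EllipticCurves.gross_zagier N W K) ∧ (∀ (N : ℕ) [NeZero N] (W :
      WeierstrassCurve ℚ) (K : Type) [Field K] [NumberField K],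
      Literature.NumberTheory.EllipticCurves.kolyvagin N W K) ∧
      Literature.NumberTheory.EllipticCurves.rank_eq_analyticRank_of_analyticRank_le_one ∧
      Literature.NumberTheory.EllipticCurves.waldspurger_exists_heegnerField_twist_ne_zero ∧ (∀ W :
      WeierstrassCurve ℚ, W.even_analyticRank_iff) ∧ (∀ (W : WeierstrassCurve ℚ) (K : Type) [Field
      K] [NumberField K], Literature.NumberTheory.EllipticCurves.exists_isHeegnerPoint W K)) :
    Summit.BirchSwinnertonDyer.Rank1Residual.X12.CMAtTwo := by
  intro p hp h9 h3 B _ _ hB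
  obtain ⟨hHSY, hBF, hmod, hLLT, hKob, hGZ, hKo, hGZK, hWa, hpar, hHP⟩ := hF
  obtain ⟨hr, -, -⟩ :=
    Summit.BirchSwinnertonDyer.Rank1Residual.X12.CubeSumFamilies.bsdp_three_of_thm14' hHSY
      hBF hmod hp h9 h3 B hB
  have hcm : B.HasCM := Summit.BirchSwinnertonDyer.Rank1Residual.X12.Sylvester.hasCM_of_model B hB
  have hw : B.rootNumber = -1 := by
    rcases B.rootNumber_eq_one_or with hw | hw
    · exact absurd ((hpar B).mpr hw) (by rw [hr]; exact Nat.not_even_one)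
    · exact hw
  obtain ⟨K, _, _, hKq, hH, hLt⟩ := hWa.exists B hw
  haveI : NeZero (B.conductorNorm ℤ) := ⟨(B.conductorNorm_pos_holds).ne'⟩
  obtain ⟨P, Dt, Hg, ι, hP⟩ := hHP B K hKq hH
  have hd : (NumberField.discr K : ℚ) ≠ 0 := by exact_mod_cast NumberField.discr_ne_zero K
  haveI := B.isElliptic_quadraticTwist hd
  obtain ⟨Cd, hCd⟩ :=
    WeierstrassCurve.hasGlobalMinimalModel_rat_holds (B.quadraticTwist (NumberField.discr K : ℚ))
  haveI := hCd
  obtain ⟨k, hk12, hkiff, hiff⟩ :=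
    Summit.BirchSwinnertonDyer.Rank1Residual.P2.bsdp_two_iff_cmHeegnerIndex B (B.conductorNorm ℤ) K
      Dt Hg ι P (hGZ _ B K) (hKo _ B K) hGZK hmod hBF hcm hKq hH hP hr hLt
      (Cd • B.quadraticTwist (NumberField.discr K : ℚ)) Cd rfl
  exact hiff.mpr (le_antisymm
    (hlo p hp h9 h3 B hB (B.conductorNorm ℤ) K Dt Hg ι P _ Cd k hcm hr hKq hH hP hLt rfl hk12 hkiff)
    (hup p hp h9 h3 B hB (B.conductorNorm ℤ) K Dt Hg ι P _ Cd k hcm hr hKq hH hP hLt rfl hk12 hkiff))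


/-- K8. C-cc-1 on the signed local type `(p, I₀*)`, the two residual conjuncts (off-type, `p = 3`),
the print readings and the published facts give the rung leaf `X12.CMInertBad`, by the landed O10
consumer `X12.O10.bsdp_of_hasSignedLocalType_IstarZero_of_valuation_of_readings` and
`Typed.missingPPartAt_of_bsdp`. -/
theorem cmInertBad_of_inputs
(h₁ : ∀ (p : ℕ) [Fact p.Prime], 5 ≤ p → ∀ (W : WeierstrassCurve ℚ) [W.IsElliptic]
      [W.IsGloballyMinimal], Summit.BirchSwinnertonDyer.Rank1Residual.X12.O10.HasSignedLocalType W p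
      (.Istar 0) → W.analyticRank = 1 →
      Summit.BirchSwinnertonDyer.Rank1Residual.Additive.QuadraticBranchPAdicGrossZagierValuationAt W
      p)
(h₂ : ∀ (W : WeierstrassCurve ℚ) [W.IsElliptic] [W.IsGloballyMinimal] (p : ℕ) [Fact p.Prime],
      W.HasCM → W.analyticRank = 1 → Literature.NumberTheory.EllipticCurves.Rank1Residual.CMInert W
      p → ¬ Literature.NumberTheory.EllipticCurves.Rank1Residual.Good W p → 5 ≤ p → ¬
      Summit.BirchSwinnertonDyer.Rank1Residual.X12.O10.HasSignedLocalType W p (.Istar 0) →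
      Literature.NumberTheory.EllipticCurves.Rank1Residual.Typed.X12.MissingInputAt W p)
(h₃ : ∀ (W : WeierstrassCurve ℚ) [W.IsElliptic] [W.IsGloballyMinimal] [Fact (Nat.Prime 3)], W.HasCM
      → W.analyticRank = 1 → Literature.NumberTheory.EllipticCurves.Rank1Residual.CMInert W 3 → ¬
      Literature.NumberTheory.EllipticCurves.Rank1Residual.Good W 3 →
      Literature.NumberTheory.EllipticCurves.Rank1Residual.Typed.X12.MissingInputAt W 3)
(h₅ : ∀ (p : ℕ) [Fact p.Prime], 5 ≤ p → (∀ (V : WeierstrassCurve ℚ) [V.IsElliptic]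
      [V.IsGloballyMinimal], V.HasCM → V.HasGoodReductionAtPrime p →
      Literature.NumberTheory.EllipticCurves.Rank1Residual.CMInert V p →
      Summit.BirchSwinnertonDyer.Rank1Residual.Additive.QuadraticBranchPlusMainConjectureAt V p) ∧
      (∀ (W : WeierstrassCurve ℚ) [W.IsElliptic] [W.IsGloballyMinimal],
      Summit.BirchSwinnertonDyer.Rank1Residual.X12.O10.HasSignedLocalType W p (.Istar 0) →
      W.analyticRank = 1 →
      Summit.BirchSwinnertonDyer.Rank1Residual.Additive.OddBranchStrictMinusNoFiniteSubmoduleAt W p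
      ∧ ∀ (V : WeierstrassCurve ℚ) [V.IsElliptic] [V.IsGloballyMinimal] (C :
      WeierstrassCurve.VariableChange ℚ) {N : ℕ} [NeZero N] {f : CuspForm (CongruenceSubgroup.Gamma0
      N) 2}, p ≠ 2 → C • W.quadraticTwist ((-1) ^ (p / 2) * p) = V → V.HasGoodReductionAtPrime p →
      V.frobeniusTrace p = 0 →
      Summit.BirchSwinnertonDyer.Rank1Residual.Additive.QuadraticBranchPlusMainConjectureAt V p →
      Literature.NumberTheory.EllipticCurves.ModularForms.IsNewformOf V f → ∀ (ϖ : ℚ), (if Even (p /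
      2) then (ϖ : ℝ) * V.realPeriodRat =
      Literature.NumberTheory.EllipticCurves.ModularForms.plusPeriod f else (ϖ : ℝ) *
      V.imaginaryPeriodRat = Literature.NumberTheory.EllipticCurves.ModularForms.minusPeriod f) → ∀
      (Lη : Literature.NumberTheory.EllipticCurves.IwasawaAlgebra p),
      Summit.BirchSwinnertonDyer.Rank1Residual.Additive.IsQuadraticBranchMinusLFunction f p ϖ Lη → ∀
      (κ : Literature.NumberTheory.EllipticCurves.ZpExtension ℚ p) (γ : Field.absoluteGaloisGroup
      ℚ), κ.IsCyclotomic → κ.IsTopGenerator γ →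
      Literature.NumberTheory.EllipticCurves.IsCyclotomicVariable p γ → ∀ (D :
      Summit.BirchSwinnertonDyer.Rank1Residual.Additive.StrictSignedSelmerDualData W κ ℚ_[p] γ (-1))
      (L' : Literature.NumberTheory.EllipticCurves.IwasawaAlgebra p), Lη = PowerSeries.X * L' →
      D.charIdeal = Ideal.span {L'}))
(h₆ : WeierstrassCurve.hasEntireLFunction_rat ∧
      Literature.NumberTheory.EllipticCurves.GrossZagier1986_thm_I_7_3 ∧
      Literature.NumberTheory.EllipticCurves.rank_eq_analyticRank_of_analyticRank_le_one ∧
      Literature.NumberTheory.GaloisCohomology.poitouTate_selmerStructure_duality_real ℚ ∧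
      Literature.NumberTheory.EllipticCurves.ModularForms.exists_isNewformOf ∧
      Literature.NumberTheory.EllipticCurves.ModularForms.mazur_not_dvd_maninConstant_of_odd) :
    Summit.BirchSwinnertonDyer.Rank1Residual.X12.CMInertBad := by
  intro W _ _ p _ hCM hr hp2 hin hbad
  have hp : p.Prime := Fact.out
  by_cases h3 : p = 3
  · subst h3
    exact h₃ W hCM hr hin hbad
  · have hp5 : 5 ≤ p := by
      by_contra hlt
      have hlt' : p < 5 := Nat.lt_of_not_le hlt
      interval_cases p
      · exact Nat.not_prime_zero hp
      · exact Nat.not_prime_one hp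
      · exact hp2 rfl
      · exact h3 rfl
      · exact absurd hp (by decide)
    by_cases hT : Summit.BirchSwinnertonDyer.Rank1Residual.X12.O10.HasSignedLocalType W p (.Istar 0)
    · obtain ⟨hmod, hGZ, hGZK, hPT, hnf, hM⟩ := h₆
      obtain ⟨hC1, hRd⟩ := h₅ p hp5
      obtain ⟨hR2, h74x⟩ := hRd W hT hr
      have hB : Literature.NumberTheory.EllipticCurves.BSDp W p :=
        Summit.BirchSwinnertonDyer.Rank1Residual.X12.O10.bsdp_of_hasSignedLocalType_IstarZero_of_valuation_of_readings
          hmod hGZ hGZK hPT hnf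
          (Summit.BirchSwinnertonDyer.Rank1Residual.Additive.periodRatio_of_mazur p hM hp5) hC1 W
          (h₁ p hp5 W hT hr) hR2 h74x hT hr hp5
      haveI : Finite W.sha := (hGZK W (by rw [hr])).2
      exact fun _ => Literature.NumberTheory.EllipticCurves.Rank1Residual.Typed.missingPPartAt_of_bsdp W p hB
    · exact h₂ W p hCM hr hin hbad hp5 hT


end Summit.BirchSwinnertonDyer.BirchSwinnertonDyer.Rank1Residual.CMRungInputs
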